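import Mathlib.LinearAlgebra.Matrix.Transvection
import Mathlib.LinearAlgebra.Matrix.SpecialLinearGroup
import Mathlib.GroupTheory.Commutator.Basic
import Mathlib.Data.Real.Basic

/-!
# `SL₂(F)` is perfect

For a field `F` containing an element `a` with `a ≠ 0` and `a² ≠ 1` (every field of
characteristic zero, with `a = 2`), the commutator subgroup of `SL (Fin 2) F` is the whole
group: `commutator (SL (Fin 2) F) = ⊤`.

Proof: `d(a) = diag(a, a⁻¹)` conjugates the transvection `E₁₂(s) = !![1, s; 0, 1]` to
`E₁₂(a² s)`, so `⁅d(a), E₁₂(s)⁆ = E₁₂((a² - 1) s)` and every `E₁₂(c)` is a commutator; likewise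
for `E₂₁(c)` (with `d(a⁻¹)`); `diag(a, a⁻¹) = w(a) w(1)⁻¹` with `w(a) = E₁₂(a) E₂₁(-a⁻¹) E₁₂(a)`
is a product of transvections; and Mathlib's transvection decomposition
`Matrix.exists_list_transvec_mul_diagonal_mul_list_transvec` writes every matrix as
`L * diagonal D * L'` with `L, L'` products of transvections, `det (diagonal D) = 1` when the
matrix is in `SL₂`.  This is the algebraic input of `T5SL2Unimodular` (through
`T5UnimodularPerfect`: a perfect locally compact group is unimodular).

Blind lane: Mathlib only; no sorry; axioms ⊆ {propext, Classical.choice, Quot.sound}.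
-/

namespace Summit.Ventures.HodgeRepro2.T5SL2Perfect

open Matrix Matrix.SpecialLinearGroup
open scoped commutatorElement

variable {F : Type*} [Field F]

/-- The upper unipotent element `E₁₂(c) = !![1, c; 0, 1]` of `SL₂(F)`. -/
def upper (c : F) : Matrix.SpecialLinearGroup (Fin 2) F :=
  ⟨!![1, c; 0, 1], by simp [Matrix.det_fin_two_of]⟩

/-- The lower unipotent element `E₂₁(c) = !![1, 0; c, 1]` of `SL₂(F)`. -/
def lower (c : F) : Matrix.SpecialLinearGroup (Fin 2) F :=
  ⟨!![1, 0; c, 1], by simp [Matrix.det_fin_two_of]⟩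

/-- The diagonal element `d(a) = diag(a, a⁻¹)` of `SL₂(F)`, `a ≠ 0`. -/
def diag (a : F) (ha : a ≠ 0) : Matrix.SpecialLinearGroup (Fin 2) F :=
  ⟨!![a, 0; 0, a⁻¹], by simp [Matrix.det_fin_two_of, ha]⟩

/-- The matrix of `E₁₂(c)`. -/
@[simp] lemma coe_upper (c : F) :
    ((upper c : Matrix.SpecialLinearGroup (Fin 2) F) : Matrix (Fin 2) (Fin 2) F) =
      !![1, c; 0, 1] :=
  rfl

/-- The matrix of `E₂₁(c)`. -/
@[simp] lemma coe_lower (c : F) :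
    ((lower c : Matrix.SpecialLinearGroup (Fin 2) F) : Matrix (Fin 2) (Fin 2) F) =
      !![1, 0; c, 1] :=
  rfl

/-- The matrix of `d(a)`. -/
@[simp] lemma coe_diag (a : F) (ha : a ≠ 0) :
    ((diag a ha : Matrix.SpecialLinearGroup (Fin 2) F) : Matrix (Fin 2) (Fin 2) F) =
      !![a, 0; 0, a⁻¹] :=
  rfl

/-- `E₁₂(c) E₁₂(d) = E₁₂(c + d)`. -/
lemma upper_mul_upper (c d : F) : (upper c : Matrix.SpecialLinearGroup (Fin 2) F) * upper d = upper (c + d) := by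
  ext i j
  fin_cases i <;> fin_cases j
  · simp [upper, Matrix.mul_apply, Fin.sum_univ_two]
  · simp [upper, Matrix.mul_apply, Fin.sum_univ_two]
    ring
  · simp [upper, Matrix.mul_apply, Fin.sum_univ_two]
  · simp [upper, Matrix.mul_apply, Fin.sum_univ_two]

/-- `E₂₁(c) E₂₁(d) = E₂₁(c + d)`. -/
lemma lower_mul_lower (c d : F) : (lower c : Matrix.SpecialLinearGroup (Fin 2) F) * lower d = lower (c + d) := by
  ext i j
  fin_cases i <;> fin_cases j <;> simp [lower, Matrix.mul_apply, Fin.sum_univ_two]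

/-- `E₁₂(c)⁻¹ = E₁₂(-c)`. -/
lemma upper_inv (c : F) : (upper c : Matrix.SpecialLinearGroup (Fin 2) F)⁻¹ = upper (-c) := by
  ext i j
  fin_cases i <;> fin_cases j <;> simp [upper, Matrix.SpecialLinearGroup.coe_inv, Matrix.adjugate_fin_two_of]

/-- `E₂₁(c)⁻¹ = E₂₁(-c)`. -/
lemma lower_inv (c : F) : (lower c : Matrix.SpecialLinearGroup (Fin 2) F)⁻¹ = lower (-c) := by
  ext i j
  fin_cases i <;> fin_cases j <;> simp [lower, Matrix.SpecialLinearGroup.coe_inv, Matrix.adjugate_fin_two_of]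

/-- `d(a) E₁₂(s) d(a)⁻¹ = E₁₂(a² s)`. -/
lemma diag_mul_upper_mul_diag_inv (a : F) (ha : a ≠ 0) (s : F) :
    (diag a ha : Matrix.SpecialLinearGroup (Fin 2) F) * upper s * (diag a ha)⁻¹ = upper (a ^ 2 * s) := by
  ext i j
  fin_cases i <;> fin_cases j
  · simp [diag, upper, Matrix.SpecialLinearGroup.coe_inv, Matrix.adjugate_fin_two_of,
      Matrix.mul_apply, Fin.sum_univ_two, ha]
  · simp [diag, upper, Matrix.SpecialLinearGroup.coe_inv, Matrix.adjugate_fin_two_of,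
      Matrix.mul_apply, Fin.sum_univ_two]
    ring
  · simp [diag, upper, Matrix.SpecialLinearGroup.coe_inv, Matrix.adjugate_fin_two_of,
      Matrix.mul_apply, Fin.sum_univ_two]
  · simp [diag, upper, Matrix.SpecialLinearGroup.coe_inv, Matrix.adjugate_fin_two_of,
      Matrix.mul_apply, Fin.sum_univ_two, ha]

/-- `d(a) E₂₁(s) d(a)⁻¹ = E₂₁(a⁻² s)`. -/
lemma diag_mul_lower_mul_diag_inv (a : F) (ha : a ≠ 0) (s : F) :
    (diag a ha : Matrix.SpecialLinearGroup (Fin 2) F) * lower s * (diag a ha)⁻¹ = lower (a⁻¹ ^ 2 * s) := by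
  ext i j
  fin_cases i <;> fin_cases j
  · simp [diag, lower, Matrix.SpecialLinearGroup.coe_inv, Matrix.adjugate_fin_two_of,
      Matrix.mul_apply, Fin.sum_univ_two, ha]
  · simp [diag, lower, Matrix.SpecialLinearGroup.coe_inv, Matrix.adjugate_fin_two_of,
      Matrix.mul_apply, Fin.sum_univ_two]
  · simp [diag, lower, Matrix.SpecialLinearGroup.coe_inv, Matrix.adjugate_fin_two_of,
      Matrix.mul_apply, Fin.sum_univ_two]
    ring
  · simp [diag, lower, Matrix.SpecialLinearGroup.coe_inv, Matrix.adjugate_fin_two_of,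
      Matrix.mul_apply, Fin.sum_univ_two, ha]

/-- `⁅d(a), E₁₂(s)⁆ = E₁₂((a² - 1) s)`. -/
lemma commutator_diag_upper (a : F) (ha : a ≠ 0) (s : F) :
    ⁅(diag a ha : Matrix.SpecialLinearGroup (Fin 2) F), upper s⁆ = upper ((a ^ 2 - 1) * s) := by
  rw [commutatorElement_def, diag_mul_upper_mul_diag_inv, upper_inv, upper_mul_upper]
  congr 1
  ring

/-- `⁅d(a⁻¹), E₂₁(s)⁆ = E₂₁((a² - 1) s)`. -/
lemma commutator_diag_lower (a : F) (ha : a ≠ 0) (s : F) :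
    ⁅(diag a⁻¹ (inv_ne_zero ha) : Matrix.SpecialLinearGroup (Fin 2) F), lower s⁆ = lower ((a ^ 2 - 1) * s) := by
  rw [commutatorElement_def, diag_mul_lower_mul_diag_inv, lower_inv, lower_mul_lower, inv_inv]
  congr 1
  ring

/-- Every `E₁₂(c)` lies in the commutator subgroup (given `a ≠ 0` with `a² ≠ 1`). -/
lemma upper_mem_commutator (a : F) (ha : a ≠ 0) (ha2 : a ^ 2 ≠ 1) (c : F) :
    (upper c : Matrix.SpecialLinearGroup (Fin 2) F) ∈ commutator (Matrix.SpecialLinearGroup (Fin 2) F) := by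
  have h : (a ^ 2 - 1) ≠ 0 := sub_ne_zero.mpr ha2
  have : upper c = ⁅(diag a ha : Matrix.SpecialLinearGroup (Fin 2) F), upper (c / (a ^ 2 - 1))⁆ := by
    rw [commutator_diag_upper a ha, mul_div_cancel₀ c h]
  rw [this, commutator_def]
  exact Subgroup.commutator_mem_commutator (Subgroup.mem_top _) (Subgroup.mem_top _)

/-- Every `E₂₁(c)` lies in the commutator subgroup (given `a ≠ 0` with `a² ≠ 1`). -/
lemma lower_mem_commutator (a : F) (ha : a ≠ 0) (ha2 : a ^ 2 ≠ 1) (c : F) :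
    (lower c : Matrix.SpecialLinearGroup (Fin 2) F) ∈ commutator (Matrix.SpecialLinearGroup (Fin 2) F) := by
  have h : (a ^ 2 - 1) ≠ 0 := sub_ne_zero.mpr ha2
  have : lower c = ⁅(diag a⁻¹ (inv_ne_zero ha) : Matrix.SpecialLinearGroup (Fin 2) F), lower (c / (a ^ 2 - 1))⁆ := by
    rw [commutator_diag_lower a ha, mul_div_cancel₀ c h]
  rw [this, commutator_def]
  exact Subgroup.commutator_mem_commutator (Subgroup.mem_top _) (Subgroup.mem_top _)

/-- `d(b) = w(b) w(1)⁻¹` with `w(b) = E₁₂(b) E₂₁(-b⁻¹) E₁₂(b)`: the diagonal element is a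
product of six transvections. -/
lemma diag_eq_prod (b : F) (hb : b ≠ 0) :
    (diag b hb : Matrix.SpecialLinearGroup (Fin 2) F) =
      upper b * lower (-b⁻¹) * upper b * (upper 1 * lower (-1) * upper 1)⁻¹ := by
  have hw : ((upper 1 * lower (-1) * upper 1 : Matrix.SpecialLinearGroup (Fin 2) F) : Matrix (Fin 2) (Fin 2) F) =
      !![0, 1; -1, 0] := by
    ext i j
    fin_cases i <;> fin_cases j <;> simp [upper, lower, Matrix.mul_apply, Fin.sum_univ_two]
  ext i j
  rw [Matrix.SpecialLinearGroup.coe_mul, Matrix.SpecialLinearGroup.coe_inv, hw,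
    Matrix.adjugate_fin_two_of]
  fin_cases i <;> fin_cases j <;>
    simp [diag, upper, lower, Matrix.mul_apply, Fin.sum_univ_two, hb]

/-- Every `d(b)` lies in the commutator subgroup. -/
lemma diag_mem_commutator (a : F) (ha : a ≠ 0) (ha2 : a ^ 2 ≠ 1) (b : F) (hb : b ≠ 0) :
    (diag b hb : Matrix.SpecialLinearGroup (Fin 2) F) ∈ commutator (Matrix.SpecialLinearGroup (Fin 2) F) := by
  rw [diag_eq_prod]
  have hu := upper_mem_commutator a ha ha2
  have hl := lower_mem_commutator a ha ha2
  exact Subgroup.mul_mem _ (Subgroup.mul_mem _ (Subgroup.mul_mem _ (hu b) (hl _)) (hu b))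
    (Subgroup.inv_mem _ (Subgroup.mul_mem _ (Subgroup.mul_mem _ (hu 1) (hl _)) (hu 1)))

/-- `transvection 0 1 c = !![1, c; 0, 1]`. -/
lemma transvection_zero_one (c : F) : transvection (0 : Fin 2) 1 c = !![1, c; 0, 1] := by
  ext i j
  fin_cases i <;> fin_cases j <;> simp [Matrix.transvection]

/-- `transvection 1 0 c = !![1, 0; c, 1]`. -/
lemma transvection_one_zero (c : F) : transvection (1 : Fin 2) 0 c = !![1, 0; c, 1] := by
  ext i j
  fin_cases i <;> fin_cases j <;> simp [Matrix.transvection]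

/-- Every transvection matrix of size `2` is the matrix of an element of the commutator
subgroup of `SL₂(F)`. -/
lemma exists_mem_commutator_coe_eq_toMatrix (a : F) (ha : a ≠ 0) (ha2 : a ^ 2 ≠ 1)
    (t : TransvectionStruct (Fin 2) F) :
    ∃ g : Matrix.SpecialLinearGroup (Fin 2) F, g ∈ commutator (Matrix.SpecialLinearGroup (Fin 2) F) ∧
      (g : Matrix (Fin 2) (Fin 2) F) = t.toMatrix := by
  obtain ⟨i, j, hij, c⟩ := t
  fin_cases i <;> fin_cases j
  · exact absurd rfl hij
  · exact ⟨upper c, upper_mem_commutator a ha ha2 c, by simp [transvection_zero_one]⟩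
  · exact ⟨lower c, lower_mem_commutator a ha ha2 c, by simp [transvection_one_zero]⟩
  · exact absurd rfl hij

/-- A product of transvection matrices of size `2` is the matrix of an element of the commutator
subgroup. -/
lemma exists_mem_commutator_coe_eq_prod (a : F) (ha : a ≠ 0) (ha2 : a ^ 2 ≠ 1)
    (L : List (TransvectionStruct (Fin 2) F)) :
    ∃ g : Matrix.SpecialLinearGroup (Fin 2) F, g ∈ commutator (Matrix.SpecialLinearGroup (Fin 2) F) ∧
      (g : Matrix (Fin 2) (Fin 2) F) = (L.map TransvectionStruct.toMatrix).prod := by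
  induction L with
  | nil => exact ⟨1, Subgroup.one_mem _, by simp⟩
  | cons t L ih =>
    obtain ⟨g, hg, hgt⟩ := exists_mem_commutator_coe_eq_toMatrix a ha ha2 t
    obtain ⟨g', hg', hgL⟩ := ih
    exact ⟨g * g', Subgroup.mul_mem _ hg hg', by
      simp [Matrix.SpecialLinearGroup.coe_mul, hgt, hgL]⟩

/-- A diagonal matrix of determinant `1` is the matrix of an element of the commutator
subgroup. -/
lemma exists_mem_commutator_coe_eq_diagonal (a : F) (ha : a ≠ 0) (ha2 : a ^ 2 ≠ 1)
    (D : Fin 2 → F) (hD : det (diagonal D) = 1) :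
    ∃ g : Matrix.SpecialLinearGroup (Fin 2) F, g ∈ commutator (Matrix.SpecialLinearGroup (Fin 2) F) ∧
      (g : Matrix (Fin 2) (Fin 2) F) = diagonal D := by
  rw [Matrix.det_diagonal, Fin.prod_univ_two] at hD
  have h0 : D 0 ≠ 0 := by
    intro h; rw [h, zero_mul] at hD; exact zero_ne_one hD
  have h1 : D 1 = (D 0)⁻¹ := eq_inv_of_mul_eq_one_right hD
  refine ⟨diag (D 0) h0, diag_mem_commutator a ha ha2 (D 0) h0, ?_⟩
  rw [coe_diag, Matrix.diagonal_fin_two, h1]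

/-- **`SL₂(F)` is perfect**: `commutator (SL (Fin 2) F) = ⊤` whenever `F` has an element `a`
with `a ≠ 0`, `a² ≠ 1`. -/
theorem commutator_eq_top (a : F) (ha : a ≠ 0) (ha2 : a ^ 2 ≠ 1) :
    commutator (Matrix.SpecialLinearGroup (Fin 2) F) = ⊤ := by
  rw [eq_top_iff]
  intro g _
  obtain ⟨L, L', D, hg⟩ :=
    Matrix.Pivot.exists_list_transvec_mul_diagonal_mul_list_transvec (g : Matrix (Fin 2) (Fin 2) F)
  have hD : det (diagonal D) = 1 := by
    have := Matrix.SpecialLinearGroup.det_coe g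
    rw [hg, Matrix.det_mul, Matrix.det_mul, TransvectionStruct.det_toMatrix_prod,
      TransvectionStruct.det_toMatrix_prod, one_mul, mul_one] at this
    exact this
  obtain ⟨gL, hgL, hL⟩ := exists_mem_commutator_coe_eq_prod a ha ha2 L
  obtain ⟨gL', hgL', hL'⟩ := exists_mem_commutator_coe_eq_prod a ha ha2 L'
  obtain ⟨gD, hgD, hDD⟩ := exists_mem_commutator_coe_eq_diagonal a ha ha2 D hD
  have : g = gL * gD * gL' := by
    apply Subtype.ext
    rw [Matrix.SpecialLinearGroup.coe_mul, Matrix.SpecialLinearGroup.coe_mul, hL, hL', hDD, hg]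
  rw [this]
  exact Subgroup.mul_mem _ (Subgroup.mul_mem _ hgL hgD) hgL'

/-- `SL₂(F)` is perfect for every field of characteristic zero (`a = 2`). -/
theorem commutator_eq_top_of_charZero [CharZero F] :
    commutator (Matrix.SpecialLinearGroup (Fin 2) F) = ⊤ :=
  commutator_eq_top (2 : F) two_ne_zero (by norm_num)

/-- `SL₂(ℝ)` is perfect. -/
theorem commutator_eq_top_real : commutator (Matrix.SpecialLinearGroup (Fin 2) ℝ) = ⊤ :=
  commutator_eq_top_of_charZero

end Summit.Ventures.HodgeRepro2.T5SL2Perfect
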